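import Literature.Barriers.NavierStokesRegularity.NavierStokesInequalityCantorSwitching
import Literature.Barriers.NavierStokesRegularity.SchefferSwitchedField
import HarnessLib

/-!
# Scheffer's Cantor-set switching: the glued field of a sequence of pieces

Barrier catalogue support file for `NavierStokesRegularity` (D-0021), second layer of the
decomposition of `Literature.Barriers.NavierStokesRegularity.NavierStokesInequalityNearlyOneDimSingularSet`
(Scheffer 1987 = Ożański 2020 Thm. 1.6) after the accepted `NavierStokesInequalityCantorSwitching`
(block `IsNSICantorBlock`, facts A′ = `NSICantorSwitching`, B′ = `NSICantorBlockExists`,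
assembly). It DEFINES the glued field of the switching argument for an arbitrary SEQUENCE of
pieces `w j` on `[t_j, t_{j+1})` — Ożański 2017 (arXiv:1709.00602), (6.18) = (2.7):
`𝔲(t) = u^{(j)}(t)` if `t ∈ [t_j,t_{j+1})`, `𝔲(t) = 0` if `t ≥ T₀`; Scheffer 1987, (5.39) — as
`Scheffer.glueSeq T τ w`, of which the accepted one-field glue `Scheffer.glue T τ z u` of
`SchefferSwitchedField` (the rescaled copies `Scheffer.piece T τ z u j` of ONE field, Ożański's
Thm. 1) is the instance `w = Scheffer.piece T τ z u` (`Scheffer.glue_eq_glueSeq`, by `rfl`), and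
proves the elementary clauses of A′ for a Cantor block: agreement with the pieces, vanishing from
`T₀` on, `C^∞` slices supported in `G` (hence compactly supported), pointwise incompressibility,
and the energy class `sup_t ∫|𝔲(t)|² < ∞` ("by construction `𝔲` is divergence-free, smooth in
space, its support in space is contained in `G`", Ożański p. 6; (2.8)). The weak-solution
property itself is obtained in the sequel files from the accepted gluing principle
`isWeakNSISolution_of_piecewise` (`NavierStokesInequalityGluingWeak`), once the integrability
package of Ożański p. 6 / Scheffer's Lemma 5.12 is established for `𝔲`.

## References

* W. S. Ożański, arXiv:1709.00602 (2017), §2 pp. 6–7 ((2.7)–(2.8)), §6.2 (6.14), (6.18).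
  [`Ozanski2017NSISingular`]
* V. Scheffer, Comm. Math. Phys. 110 (1987), (5.39). [`Scheffer1987`]
-/

noncomputable section

open MeasureTheory Set Function Filter Topology TopologicalSpace
open scoped ENNReal NNReal InnerProductSpace RealInnerProductSpace ContDiff

/-! ### The glued field of a sequence of pieces (Ożański 2017, (6.18); Scheffer 1987, (5.39)) -/

namespace Literature.Barriers.NavierStokesRegularity.Scheffer

section Field

variable {E : Type*} [NormedAddCommGroup E]

open Classical in
/-- **The glued field of a sequence of pieces** (Ożański 2017, (6.18); Scheffer 1987, (5.39)):
`𝔲(t) = w j(t)` if `t ∈ [t_j, t_{j+1})` for some `j ≥ 0` (the piece is unique,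
`eq_of_mem_Ico_switchTime`), and `𝔲(t) = 0` otherwise, i.e. for `t ≥ T₀ = T/(1-τ²)` (and for
the irrelevant negative times). The one-field glue `Scheffer.glue T τ z u` is the case
`w = Scheffer.piece T τ z u` (`glue_eq_glueSeq`).
[cite: Ozanski2017NSISingular, §6.2 (6.18)] [cite: Scheffer1987, (5.39)] -/
def glueSeq (T τ : ℝ) (w : ℕ → ℝ → E → E) : ℝ → E → E := fun t x =>
  if h : ∃ j : ℕ, t ∈ Ico (switchTime T τ j) (switchTime T τ (j + 1)) then w h.choose t x else 0

/-- **The one-field glue is the sequence glue of the rescaled pieces**: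
`Scheffer.glue T τ z u = Scheffer.glueSeq T τ (Scheffer.piece T τ z u)` (Ożański's Thm. 1 is the
`M = 1` case of Thm. 14). [cite: Ozanski2017NSISingular, §2 (2.4) and §6.2 (6.18)] -/
theorem glue_eq_glueSeq [InnerProductSpace ℝ E] (T τ : ℝ) (z : E) (u : ℝ → E → E) :
    glue T τ z u = glueSeq T τ (piece T τ z u) :=
  rfl

/-- Off the switching intervals the glued field vanishes. [folklore] -/
theorem glueSeq_eq_zero_of_not {T τ : ℝ} (w : ℕ → ℝ → E → E) {t : ℝ}
    (h : ¬ ∃ j : ℕ, t ∈ Ico (switchTime T τ j) (switchTime T τ (j + 1))) :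
    glueSeq T τ w t = 0 := by
  funext x
  rw [glueSeq, dif_neg h]
  rfl

/-- **On `[t_j, t_{j+1})` the glued field is the `j`-th piece.** [cite: Ozanski2017NSISingular, §6.2 (6.18)] -/
theorem glueSeq_eq_of_mem {T τ : ℝ} (hT : 0 < T) (hτ : 0 < τ) (w : ℕ → ℝ → E → E) {t : ℝ}
    {j : ℕ} (hj : t ∈ Ico (switchTime T τ j) (switchTime T τ (j + 1))) :
    glueSeq T τ w t = w j t := by
  funext x
  have hex : ∃ j : ℕ, t ∈ Ico (switchTime T τ j) (switchTime T τ (j + 1)) := ⟨j, hj⟩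
  rw [glueSeq, dif_pos hex, eq_of_mem_Ico_switchTime hT hτ hex.choose_spec hj]

/-- **From the blow-up time on the glued field vanishes.** [cite: Ozanski2017NSISingular, §6.2 (6.18)] -/
theorem glueSeq_eq_zero_of_le {T τ : ℝ} (hT : 0 < T) (hτ₀ : 0 < τ) (hτ₁ : τ < 1)
    (w : ℕ → ℝ → E → E) {t : ℝ} (ht : blowupTime T τ ≤ t) : glueSeq T τ w t = 0 :=
  glueSeq_eq_zero_of_not w fun ⟨j, hj⟩ => by
    have := switchTime_lt_blowupTime hT hτ₀ hτ₁ (j + 1)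
    linarith [hj.2]

/-- Before time `0` the glued field vanishes (a convention; nothing is required there). [folklore] -/
theorem glueSeq_eq_zero_of_neg {T τ : ℝ} (hT : 0 < T) (hτ : 0 < τ) (w : ℕ → ℝ → E → E)
    {t : ℝ} (ht : t < 0) : glueSeq T τ w t = 0 :=
  glueSeq_eq_zero_of_not w fun ⟨j, hj⟩ => by
    have := switchTime_nonneg hT hτ j
    linarith [hj.1]

/-- For `t < 0` or `t ≥ T₀` the glued field vanishes. [folklore] -/
theorem glueSeq_eq_zero_of_mem {T τ : ℝ} (hT : 0 < T) (hτ₀ : 0 < τ) (hτ₁ : τ < 1)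
    (w : ℕ → ℝ → E → E) {t : ℝ} (ht : t ∈ Iio (0 : ℝ) ∪ Ici (blowupTime T τ)) :
    glueSeq T τ w t = 0 := by
  rcases ht with ht | ht
  · exact glueSeq_eq_zero_of_neg hT hτ₀ w ht
  · exact glueSeq_eq_zero_of_le hT hτ₀ hτ₁ w ht

end Field

end Literature.Barriers.NavierStokesRegularity.Scheffer

/-! ### The elementary clauses of the switching principle for a Cantor block -/

namespace Literature.Barriers.NavierStokesRegularity

open Scheffer Literature.MeasureTheory.Hausdorff Literature.Analysis.FluidPDE

/-- Local notation for physical space `ℝ³ = EuclideanSpace ℝ (Fin 3)`. -/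
local notation "ℝ³" => EuclideanSpace ℝ (Fin 3)

namespace IsNSICantorBlock

variable {T ν₀ τ : ℝ} {M : ℕ} {d : Fin M → ℝ³} {G : Set ℝ³} {w : ℕ → ℝ → ℝ³ → ℝ³}

/-- Consecutive switching times are distinct: `t_j < t_{j+1}`. [folklore] -/
theorem switchTime_lt (h : IsNSICantorBlock T ν₀ τ M d G w) (j : ℕ) :
    switchTime T τ j < switchTime T τ (j + 1) :=
  strictMono_switchTime h.T_pos h.τ_pos (Nat.lt_succ_self j)

/-- The slices of the pieces are `C^∞` on `[t_j, t_{j+1}]`. [cite: Ozanski2017NSISingular, §6.2 Prop. 16] -/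
theorem contDiff_piece (h : IsNSICantorBlock T ν₀ τ M d G w) {j : ℕ} {t : ℝ}
    (ht : t ∈ Icc (switchTime T τ j) (switchTime T τ (j + 1))) : ContDiff ℝ ∞ (w j t) := by
  obtain ⟨η, hη, hs⟩ := h.smooth j
  exact hs.contDiff_slice ⟨by linarith [ht.1], by linarith [ht.2]⟩

/-- The slices of the pieces are supported in `G` ((6.14) with `Γ_m(G) ⊆ G`).
[cite: Ozanski2017NSISingular, §6.2 (6.14)] -/
theorem tsupport_piece_subset (h : IsNSICantorBlock T ν₀ τ M d G w) {j : ℕ} {t : ℝ}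
    (ht : t ∈ Icc (switchTime T τ j) (switchTime T τ (j + 1))) : tsupport (w j t) ⊆ G :=
  (h.tsupport_subset j t ht).trans (CantorDust.level_subset h.mapsTo j)

/-- The slices of the pieces have compact support. [folklore] -/
theorem hasCompactSupport_piece (h : IsNSICantorBlock T ν₀ τ M d G w) {j : ℕ} {t : ℝ}
    (ht : t ∈ Icc (switchTime T τ j) (switchTime T τ (j + 1))) : HasCompactSupport (w j t) :=
  h.isCompact.of_isClosed_subset (isClosed_tsupport _) (h.tsupport_piece_subset ht)

/-- The pieces vanish off `G` on `[t_j, t_{j+1}]`. [cite: Ozanski2017NSISingular, §6.2 (6.14)] -/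
theorem piece_apply_eq_zero (h : IsNSICantorBlock T ν₀ τ M d G w) {j : ℕ} {t : ℝ}
    (ht : t ∈ Icc (switchTime T τ j) (switchTime T τ (j + 1))) {x : ℝ³} (hx : x ∉ G) :
    w j t x = 0 :=
  image_eq_zero_of_notMem_tsupport fun hx' => hx (h.tsupport_piece_subset ht hx')

/-- **Smooth slices**: every slice of the glued field is `C^∞` ("smooth in space", Ożański
p. 6). [cite: Ozanski2017NSISingular, §2 p. 6] -/
theorem contDiff_glueSeq (h : IsNSICantorBlock T ν₀ τ M d G w) (t : ℝ) :
    ContDiff ℝ ∞ (glueSeq T τ w t) := by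
  by_cases hex : ∃ j : ℕ, t ∈ Ico (switchTime T τ j) (switchTime T τ (j + 1))
  · obtain ⟨j, hj⟩ := hex
    rw [glueSeq_eq_of_mem h.T_pos h.τ_pos w hj]
    exact h.contDiff_piece (Ico_subset_Icc_self hj)
  · rw [glueSeq_eq_zero_of_not w hex]
    exact contDiff_const

/-- **Supports in `G`**: every slice of the glued field is supported in `G` ("its support in
space is contained in `G`", Ożański p. 6). [cite: Ozanski2017NSISingular, §2 p. 6] -/
theorem tsupport_glueSeq_subset (h : IsNSICantorBlock T ν₀ τ M d G w) (t : ℝ) :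
    tsupport (glueSeq T τ w t) ⊆ G := by
  by_cases hex : ∃ j : ℕ, t ∈ Ico (switchTime T τ j) (switchTime T τ (j + 1))
  · obtain ⟨j, hj⟩ := hex
    rw [glueSeq_eq_of_mem h.T_pos h.τ_pos w hj]
    exact h.tsupport_piece_subset (Ico_subset_Icc_self hj)
  · rw [glueSeq_eq_zero_of_not w hex]
    intro x hx
    simp [tsupport] at hx

/-- The slices of the glued field have compact support. [folklore] -/
theorem hasCompactSupport_glueSeq (h : IsNSICantorBlock T ν₀ τ M d G w) (t : ℝ) :
    HasCompactSupport (glueSeq T τ w t) :=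
  h.isCompact.of_isClosed_subset (isClosed_tsupport _) (h.tsupport_glueSeq_subset t)

/-- The glued field vanishes off `G`. [folklore] -/
theorem glueSeq_apply_eq_zero (h : IsNSICantorBlock T ν₀ τ M d G w) (t : ℝ) {x : ℝ³}
    (hx : x ∉ G) : glueSeq T τ w t x = 0 :=
  image_eq_zero_of_notMem_tsupport fun hx' => hx (h.tsupport_glueSeq_subset t hx')

/-- **Incompressibility**: every slice of the glued field is divergence free ("by construction
`𝔲` is divergence-free", Ożański p. 6). [cite: Ozanski2017NSISingular, §2 p. 6] -/
theorem isDivFree_glueSeq (h : IsNSICantorBlock T ν₀ τ M d G w) (t : ℝ) :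
    VectorCalculus.IsDivFree (glueSeq T τ w t) := by
  by_cases hex : ∃ j : ℕ, t ∈ Ico (switchTime T τ j) (switchTime T τ (j + 1))
  · obtain ⟨j, hj⟩ := hex
    rw [glueSeq_eq_of_mem h.T_pos h.τ_pos w hj]
    exact h.divFree j t (Ico_subset_Icc_self hj)
  · rw [glueSeq_eq_zero_of_not w hex]
    intro x
    simp [VectorCalculus.divergence]

/-- **The energy class** `sup_t ∫|𝔲(t)|² < ∞` (Ożański (2.8), p. 30). [cite: Ozanski2017NSISingular, §2 (2.8)] -/
theorem exists_lintegral_glueSeq_le (h : IsNSICantorBlock T ν₀ τ M d G w) :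
    ∃ C : ℝ≥0, ∀ t : ℝ, ∫⁻ x, ‖glueSeq T τ w t x‖ₑ ^ 2 ≤ C := by
  obtain ⟨C, hC⟩ := h.energy
  refine ⟨C, fun t => ?_⟩
  by_cases hex : ∃ j : ℕ, t ∈ Ico (switchTime T τ j) (switchTime T τ (j + 1))
  · obtain ⟨j, hj⟩ := hex
    rw [glueSeq_eq_of_mem h.T_pos h.τ_pos w hj]
    exact hC j t (Ico_subset_Icc_self hj)
  · rw [glueSeq_eq_zero_of_not w hex]
    simp

end IsNSICantorBlock

end Literature.Barriers.NavierStokesRegularity
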